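import Mathlib
import Summits.KontsevichZagierPeriods.KontsevichZagierPeriods.Theses.SymplecticScissors

/-!
# Sketch — crux-ideate stmt-KontsevichZagierPeriods-9848 (`SymplecticScissors.PlanarSAZylev`), ideator 3

Idea `measured-refinement-monoid-zylev`: Zylev's cancellation is a three-line theorem about
MEASURED REFINEMENT MONOIDS ("small summands cancel"); the planar type monoid of the KZ
pseudogroup (piecewise `ℚ`-semialgebraic `C¹` injections with `|det| = 1`, regions mod null sets)
is one. Part A is PROVED here (pure algebra). Part B states the four geometric inputs and the
transfer to the crux as `Prop`s over tree declarations, with the composition checked.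
-/

open MeasureTheory Set

namespace IdeaSketch.MeasuredRefinementMonoid

/-! ## Part A — the abstract lever (proved) -/

/-- **Small summands cancel.** In an additive commutative monoid with a non-negative additive
`v`, the binary REFINEMENT property and the STRICT EMBEDDING property (`v b < v a → b ≤ a`),
`x + p = y + p` with `2·v p < v x` forces `x = y`. (Zylev's Lemma 13, Boltianskii 1978 §16,
reduced to one refinement and one embedding.) -/
theorem smallSummandsCancel {M : Type*} [AddCommMonoid M] (v : M →+ ℝ)
    (hv0 : ∀ a, 0 ≤ v a)
    (href : ∀ a₁ a₂ b₁ b₂ : M, a₁ + a₂ = b₁ + b₂ →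
      ∃ c₁₁ c₁₂ c₂₁ c₂₂ : M, a₁ = c₁₁ + c₁₂ ∧ a₂ = c₂₁ + c₂₂ ∧ b₁ = c₁₁ + c₂₁ ∧ b₂ = c₁₂ + c₂₂)
    (hemb : ∀ a b : M, v b < v a → ∃ d, b + d = a)
    {x y p : M} (h : x + p = y + p) (hp : 2 * v p < v x) : x = y := by
  obtain ⟨c₁₁, c₁₂, c₂₁, c₂₂, hx, hpL, hy, hpR⟩ := href x p y p h
  have h1 : v c₂₂ ≤ v p := by
    have := congrArg v hpL; rw [map_add] at this; linarith [hv0 c₂₁]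
  have h2 : v c₁₂ ≤ v p := by
    have := congrArg v hpR; rw [map_add] at this; linarith [hv0 c₂₂]
  have h3 : v c₁₁ = v x - v c₁₂ := by
    have := congrArg v hx; rw [map_add] at this; linarith
  have hlt : v c₂₂ < v c₁₁ := by linarith
  obtain ⟨n, hn⟩ := hemb c₁₁ c₂₂ hlt
  calc x = c₁₁ + c₁₂ := hx
    _ = (c₂₂ + n) + c₁₂ := by rw [hn]
    _ = n + (c₁₂ + c₂₂) := by abel
    _ = n + p := by rw [← hpR]
    _ = n + (c₂₁ + c₂₂) := by rw [← hpL]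
    _ = (c₂₂ + n) + c₂₁ := by abel
    _ = c₁₁ + c₂₁ := by rw [hn]
    _ = y := hy.symm

/-- **Abstract Zylev: measured refinement monoids are cancellative.** Add FAITHFULNESS
(`v a = 0 → a = 0`) and DIVISIBILITY (every element is a finite sum of elements of `v`-size `< ε`):
then `a + c = b + c → a = b`. Proof: cut `c` into pieces of size `< v a / 2` and peel them one at a
time with `smallSummandsCancel`. -/
theorem cancel_of_measuredRefinement {M : Type*} [AddCommMonoid M] (v : M →+ ℝ)
    (hv0 : ∀ a, 0 ≤ v a) (hfaith : ∀ a, v a = 0 → a = 0)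
    (href : ∀ a₁ a₂ b₁ b₂ : M, a₁ + a₂ = b₁ + b₂ →
      ∃ c₁₁ c₁₂ c₂₁ c₂₂ : M, a₁ = c₁₁ + c₁₂ ∧ a₂ = c₂₁ + c₂₂ ∧ b₁ = c₁₁ + c₂₁ ∧ b₂ = c₁₂ + c₂₂)
    (hemb : ∀ a b : M, v b < v a → ∃ d, b + d = a)
    (hdiv : ∀ (c : M) (ε : ℝ), 0 < ε → ∃ l : List M, l.sum = c ∧ ∀ p ∈ l, v p < ε)
    (a b c : M) (h : a + c = b + c) : a = b := by
  by_cases ha : v a = 0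
  · have hb : v b = 0 := by
      have := congrArg v h; rw [map_add, map_add] at this; linarith
    rw [hfaith a ha, hfaith b hb]
  · have hapos : 0 < v a := lt_of_le_of_ne (hv0 a) (Ne.symm ha)
    obtain ⟨l, rfl, hl⟩ := hdiv c (v a / 2) (by linarith)
    suffices H : ∀ l : List M, (∀ p ∈ l, v p < v a / 2) → a + l.sum = b + l.sum → a = b from
      H l hl h
    intro l
    induction l with
    | nil => intro _ h; simpa using h
    | cons p l ih =>
      intro hl h
      apply ih (fun q hq => hl q (List.mem_cons_of_mem p hq))
      have hp : v p < v a / 2 := hl p (by simp)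
      have hsum : 0 ≤ v l.sum := by
        rw [map_list_sum]
        exact List.sum_nonneg (fun x hx => by
          obtain ⟨q, -, rfl⟩ := List.mem_map.mp hx
          exact hv0 q)
      have hx : 2 * v p < v (a + l.sum) := by rw [map_add]; linarith
      refine smallSummandsCancel v hv0 href hemb ?_ hx
      simp only [List.sum_cons] at h
      calc a + l.sum + p = a + (p + l.sum) := by abel
        _ = b + (p + l.sum) := h
        _ = b + l.sum + p := by abel

/-! ## Part B — the planar instance: statements over tree declarations -/

open Literature.NumberTheory.Transcendental Literature.ModelTheory.ExponentialFields

/-- The planar KZ pseudogroup equivalence (mod null sets): `A ~ B` iff an open `ℚ`-semialgebraic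
full-measure part of `A` is carried by ONE `ℚ`-semialgebraic `C¹` injection with `|det| = 1`
onto a full-measure part of `B`. Piecewise maps on finitely many disjoint open pieces are single
instances. -/
def TEquiv (A B : Set (Fin 2 → ℝ)) : Prop :=
  ∃ (U : Set (Fin 2 → ℝ)) (Φ : (Fin 2 → ℝ) → (Fin 2 → ℝ)),
    U ⊆ A ∧ IsSemialgebraic ℚ U ∧ IsOpen U ∧ volume (A \ U) = 0 ∧
    IsSemialgebraicMapOn ℚ U Φ ∧ ContDiffOn ℝ 1 Φ U ∧ Set.InjOn Φ U ∧
    (∀ p ∈ U, |(fderiv ℝ Φ p).det| = 1) ∧ Φ '' U ⊆ B ∧ volume (B \ Φ '' U) = 0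

/-- `~` is symmetric (inverse function theorem on the open image; inverse of a semialgebraic
bijection is semialgebraic; `|det| = 1` is inherited). -/
def TEquivSymm : Prop :=
  ∀ A B : Set (Fin 2 → ℝ), IsSemialgebraic ℚ A → IsSemialgebraic ℚ B → TEquiv A B → TEquiv B A

/-- `~` is transitive (compose on `U₁ ∩ Φ₁⁻¹ U₂`; the discarded sets are null by the Jacobian
formula with `|det| = 1`). -/
def TEquivTrans : Prop :=
  ∀ A B C : Set (Fin 2 → ℝ), IsSemialgebraic ℚ A → IsSemialgebraic ℚ B → IsSemialgebraic ℚ C →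
    TEquiv A B → TEquiv B C → TEquiv A C

/-- **(E) Strict embedding = Boltianskii's mosaic Lemma 12 for bounded `ℚ`-regions**: if
`vol B < vol A` then `B` is `~`-equivalent to a `ℚ`-semialgebraic subset of `A` (inner/outer dyadic
cube counts, tree `innerIdx/outerIdx/exists_card_sub_card_mul_le`, null semialgebraic frontiers,
and a piecewise RATIONAL TRANSLATION cube-to-cube). -/
def MosaicEmbedding : Prop :=
  ∀ A B : Set (Fin 2 → ℝ), IsSemialgebraic ℚ A → IsSemialgebraic ℚ B →
    Bornology.IsBounded A → Bornology.IsBounded B → volume B < volume A →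
    ∃ A' : Set (Fin 2 → ℝ), A' ⊆ A ∧ IsSemialgebraic ℚ A' ∧ TEquiv B A'

/-- **Compression**: every finite-area `ℚ`-region is `~`-equivalent to a bounded one (cells of a
cylindrical decomposition; shears `(x, y) ↦ (x, y − ξ(x))` ground the bands; reflections make the
fibre length non-increasing; then the tree's monomial compression `xⱼ^η (x₁x₂)^β` followed by
`diag(q, 1)`, of Jacobian `1`, bounds each down-set — `KZMonomialCompression`,
`DownSetTail.exists_prod_le_mul_rpow`). No primitive of any function is taken. -/
def PlanarCompression : Prop :=
  ∀ A : Set (Fin 2 → ℝ), IsSemialgebraic ℚ A → volume A ≠ ⊤ →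
    ∃ B : Set (Fin 2 → ℝ), IsSemialgebraic ℚ B ∧ Bornology.IsBounded B ∧ TEquiv A B

/-- **C⁺ (the transferred crux): cancellation for the planar pseudogroup.** If `A ⊔ C ~ B ⊔ C'`
with `C ~ C'` then `A ~ B`. This is `cancel_of_measuredRefinement` instantiated on the planar type
monoid (multisets of finite-area `ℚ`-regions modulo `~`): refinement = common refinement of two
piecewise maps, `v` = area, (E) = `MosaicEmbedding` after `PlanarCompression`, divisibility =
cutting a bounded region by rational vertical lines. -/
def PlanarCancellation : Prop :=
  ∀ A B C C' : Set (Fin 2 → ℝ), IsSemialgebraic ℚ A → IsSemialgebraic ℚ B →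
    IsSemialgebraic ℚ C → IsSemialgebraic ℚ C' → volume A ≠ ⊤ → volume C ≠ ⊤ →
    Disjoint A C → Disjoint B C' → TEquiv C C' → TEquiv (A ∪ C) (B ∪ C') → TEquiv A B

/-- **Decoding (K₀ bookkeeping).** Membership of `[r] − [r']` in the planar set-chain group gives a
STABLE equivalence `A ⊔ C ~ B ⊔ C'`, `C ~ C'`, `A ~ r.domain`, `B ~ r'.domain`: apply the class map
`χ : FormalRep →+ K₀(type monoid)` (`FreeAbelianGroup.lift`; `AddLocalization ⊤`), which kills
every generator of the group (a `domainAddRel` instance is an a.e. partition, null overlaps are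
`0` mod null; a `changeOfVariablesRel` instance between integrand-`1` reps is a `~`-instance after
discarding the non-`C¹` locus, `IsSemialgebraicFunOn.exists_contDiffOn_holds`), then read
`χ[r] = χ[r']` in `K₀` as `[r] + k = [r'] + k` (`AddLocalization.mk_eq_mk_iff`). -/
def Decoding : Prop :=
  ∀ (r r' : KZ.IntegralRep 2), (∀ p ∈ r.domain, r.integrand p = 1) →
    (∀ p ∈ r'.domain, r'.integrand p = 1) →
    KZ.of r - KZ.of r' ∈ AddSubgroup.closure ((KZ.domainAddRel ∪ KZ.changeOfVariablesRel) ∩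
      (AddSubgroup.closure {x : KZ.FormalRep | ∃ s : KZ.IntegralRep 2,
        (∀ p ∈ s.domain, s.integrand p = 1) ∧ x = KZ.of s} : Set KZ.FormalRep)) →
    ∃ A B C C' : Set (Fin 2 → ℝ), IsSemialgebraic ℚ A ∧ IsSemialgebraic ℚ B ∧
      IsSemialgebraic ℚ C ∧ IsSemialgebraic ℚ C' ∧ volume A ≠ ⊤ ∧ volume C ≠ ⊤ ∧
      Disjoint A C ∧ Disjoint B C' ∧ TEquiv r.domain A ∧ TEquiv B r'.domain ∧
      TEquiv C C' ∧ TEquiv (A ∪ C) (B ∪ C')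

/-- **Bridge back to the crux's conclusion shape**: a `~`-instance between the domains of two
integrand-`1` representations is ONE `changeOfVariablesRel` instance between full-measure
restrictions (`IntegralRep.restrict`, `HasFDerivWithinAt` from `ContDiffOn` on the open piece). -/
def Bridge : Prop :=
  ∀ (r r' : KZ.IntegralRep 2), (∀ p ∈ r.domain, r.integrand p = 1) →
    (∀ p ∈ r'.domain, r'.integrand p = 1) → TEquiv r.domain r'.domain →
    ∃ (s s' : KZ.IntegralRep 2), s.domain ⊆ r.domain ∧ volume (r.domain \ s.domain) = 0 ∧
      s'.domain ⊆ r'.domain ∧ volume (r'.domain \ s'.domain) = 0 ∧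
      (∀ p ∈ s.domain, s.integrand p = 1) ∧ (∀ p ∈ s'.domain, s'.integrand p = 1) ∧
      KZ.of s - KZ.of s' ∈ KZ.changeOfVariablesRel

/-- **The transfer, checked**: Decoding + cancellation (C⁺) + transitivity + bridge ⟹ the crux
`SymplecticScissors.PlanarSAZylev` BY NAME. -/
theorem planarSAZylev_of (hD : Decoding) (hC : PlanarCancellation) (hT : TEquivTrans)
    (hB : Bridge) :
    Summit.KontsevichZagierPeriods.KontsevichZagierPeriods.Theses.SymplecticScissors.PlanarSAZylev := by
  intro r r' h1 h1' hG
  obtain ⟨A, B, C, C', hA, hBs, hCs, hC's, hAfin, hCfin, hAC, hBC', hrA, hBr', hCC', hstab⟩ :=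
    hD r r' h1 h1' hG
  have hAB : TEquiv A B := hC A B C C' hA hBs hCs hC's hAfin hCfin hAC hBC' hCC' hstab
  have hrr' : TEquiv r.domain r'.domain :=
    hT _ _ _ r.isSemialgebraic_domain hBs r'.isSemialgebraic_domain
      (hT _ _ _ r.isSemialgebraic_domain hA hBs hrA hAB) hBr'
  exact hB r r' h1 h1' hrr'

end IdeaSketch.MeasuredRefinementMonoid
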